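import Mathlib
import Literature.Analysis.OperatorTheory.BandedFirstOrderEigenvectorRegularity
import Summits.NavierStokesRegularity.FluidComputer.SkewCutGalerkinInjectivity

/-!
# Skew-cut certificate: from certificate-shaped hypotheses to an `H^∞` eigenvector in the open bracket
(END-TO-END statement in the diagonal / Hilbert-basis setting; instab4 g4, cell `ns-blowup`, 2026-08-26)

HONEST FRAMING (human ruling D-0035): nothing here is a claim about Navier–Stokes blow-up.
WHAT THIS IS NOT: not NS evidence. MODEL lane. This file only ASSEMBLES:
`SkewCutGalerkinLimit` (g3: compact extraction), `SkewCutGalerkinPerturbation` (g4: perturbed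
resolvent, exhausting projections, diagonal free part), `SkewCutGalerkinInjectivity` (g4: bracket ends
not eigenvalues ⇒ open bracket) and `Literature.Analysis.OperatorTheory.BandedFirstOrderEigenvectorRegularity`
(g4: coefficient-level elliptic bootstrap) into ONE statement whose hypotheses are the shape in which
the X0 certificate and the model deliver them:

* a Hilbert basis `b` (Fourier–Craya basis of the class), real levels `ℓ_i` (eigenvalues of
  `L₀ = νΔ`, `ℓ = −ν|k|²`), a base point `x₀` and the free resolvent `S₀ = diag(d)`,
  `d_i (x₀ − ℓ_i) = 1`, `d_i → 0` (Rellich);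
* the first-order part as a bounded `T` (`= A S₀`) with `‖T‖ < 1`, whose matrix `t i j = ⟪b i, T (b j)⟫`
  is supported on a symmetric band `nbr` of width `≤ W` and is first order: the entries
  `a i j := t i j (x₀ − ℓ_j)` of `A` satisfy `‖a i j‖ ≤ K w_j` for weights `0 ≤ w_i`, `w_i² ≤ 1 + |ℓ_i|`
  comparable along the band, and `‖d_i‖ w_i ≤ M` (the resolvent gains what the weight costs);
* the Galerkin data of the certificate: truncations = closed spans over a monotone exhausting family of
  index sets, section eigenvectors `v_n = S₀ u_n` with `‖v_n‖ = 1`, graph-norm bound `‖u_n‖ ≤ C`,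
  section eigen-equations with eigenvalues `x_n ∈ [a, c]`;
* injectivity of `R_a = 1 − T − (x₀ − a) S₀` and `R_c` (Theorem 1′ (a) at the two ends, e.g. by
  `SkewCutGalerkinInjectivity.injective_of_head_tail_coercive`).

CONCLUSION (`exists_smooth_eigenvector_Ioo`): there are `λ ∈ (a, c)` and `v ∈ H`, `‖v‖ = 1`, solving the
eigen-equation of `L₀ + A` IN COORDINATES, `ℓ_i ⟪b i, v⟫ + Σ_{j ∈ nbr i} a i j ⟪b j, v⟫ = λ ⟪b i, v⟫`
for every `i`, whose coefficients lie in EVERY weighted space: `Σ_i w_i^{2s} |⟪b i, v⟫|² < ∞` for all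
`s` (for `w ~ |k|`: `v ∈ H^s` for all `s`, hence smooth by the tree's Fourier decay ⇒ smoothness
dictionary). What is then left to reach `Literature.Analysis.FluidPDE.Torus.IsLinNSEigenvalue` for the
model is: that the certifier's exact matrices ARE these `ℓ, t` (assembly), the numeric bounds
(`‖T‖ < 1`, band growth), the certificate inputs (`x_n`, `C`, the two injectivities), the class
restriction, and Fourier synthesis + the pressure.

Mathlib + the files named above; no new definitions.
-/

noncomputable section

namespace Summit.NavierStokesRegularity.FluidComputer.SkewCutGalerkinMaster

open Filter Topology Submodule
open scoped InnerProductSpace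

variable {𝕜 H : Type*} [RCLike 𝕜] [NormedAddCommGroup H] [InnerProductSpace 𝕜 H] [CompleteSpace H]
variable {ι : Type*} (b : HilbertBasis ι 𝕜 H)

/-! ### Coordinates -/

/-- Matrix coefficients expand `⟪b i, T x⟫`: `HasSum (j ↦ ⟪b i, T (b j)⟫ ⟪b j, x⟫) ⟪b i, T x⟫`
(Parseval against `T† (b i)`). -/
theorem hasSum_inner_basis_map (T : H →L[𝕜] H) (x : H) (i : ι) :
    HasSum (fun j => ⟪b i, T (b j)⟫_𝕜 * ⟪b j, x⟫_𝕜) ⟪b i, T x⟫_𝕜 := by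
  have h := b.hasSum_inner_mul_inner (ContinuousLinearMap.adjoint T (b i)) x
  simp only [ContinuousLinearMap.adjoint_inner_left] at h
  exact h

/-- For a matrix supported on the band `nbr i`, `⟪b i, T x⟫ = Σ_{j ∈ nbr i} ⟪b i, T (b j)⟫ ⟪b j, x⟫`. -/
theorem inner_basis_map_eq_sum (T : H →L[𝕜] H) (nbr : ι → Finset ι)
    (ht0 : ∀ i j, j ∉ nbr i → ⟪b i, T (b j)⟫_𝕜 = 0) (x : H) (i : ι) :
    ⟪b i, T x⟫_𝕜 = ∑ j ∈ nbr i, ⟪b i, T (b j)⟫_𝕜 * ⟪b j, x⟫_𝕜 := by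
  rw [← (hasSum_inner_basis_map b T x i).tsum_eq]
  exact tsum_eq_sum fun j hj => by rw [ht0 i j hj, zero_mul]

omit [CompleteSpace H] in
/-- Coordinates of the diagonal free resolvent: `⟪b i, S₀ w⟫ = d_i ⟪b i, w⟫`. -/
theorem inner_basis_diagonalCLM (d : lp (fun _ : ι => 𝕜) ⊤) (w : H) (i : ι) :
    ⟪b i, b.diagonalCLM d w⟫_𝕜 = d i * ⟪b i, w⟫_𝕜 := by
  rw [← b.repr_apply_apply, ← b.repr_apply_apply, b.diagonalCLM_apply_repr]

/-! ### The end-to-end statement -/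

/-- **From certificate-shaped hypotheses to an `H^∞` eigenvector in the open bracket** (SKEWCUT-CERT
Thm 2 + Thm 1′ (a) + elliptic bootstrap, diagonal / Hilbert-basis setting; see the module docstring
for the reading of each hypothesis). -/
theorem exists_smooth_eigenvector_Ioo
    -- free part and its resolvent
    (ℓ : ι → ℝ) (x₀ : ℝ) (d : lp (fun _ : ι => 𝕜) ⊤) (hd : ∀ i, d i * ((x₀ : 𝕜) - (ℓ i : 𝕜)) = 1)
    (hd0 : Tendsto (fun i => ‖d i‖) cofinite (𝓝 0))
    -- first-order part: bounded relative bound, banded first-order matrix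
    (T : H →L[𝕜] H) (hT : ‖T‖ < 1) (nbr : ι → Finset ι)
    (hsymm : ∀ i j, j ∈ nbr i ↔ i ∈ nbr j) {W : ℕ} (hW : ∀ i, (nbr i).card ≤ W)
    (ht0 : ∀ i j, j ∉ nbr i → ⟪b i, T (b j)⟫_𝕜 = 0)
    (wgt : ι → ℝ) (hw0 : ∀ i, 0 ≤ wgt i) (hwℓ : ∀ i, wgt i ^ 2 ≤ 1 + |ℓ i|)
    {K : ℝ} (hK : 0 ≤ K)
    (ha : ∀ i j, j ∈ nbr i → ‖⟪b i, T (b j)⟫_𝕜 * ((x₀ : 𝕜) - (ℓ j : 𝕜))‖ ≤ K * wgt j)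
    {L : ℝ} (hLnn : 0 ≤ L) (hL : ∀ i j, j ∈ nbr i → wgt i ≤ L * wgt j)
    {M : ℝ} (hM : ∀ i, ‖d i‖ * wgt i ≤ M)
    -- Galerkin data of the certificate
    (F : ℕ → Set ι) (hF : Monotone F) (hFex : ∀ i, ∃ n, i ∈ F n)
    (u : ℕ → H) (hu : ∀ n, u n ∈ (span 𝕜 (b '' F n)).topologicalClosure)
    (hv1 : ∀ n, ‖b.diagonalCLM d (u n)‖ = 1) {C : ℝ} (hC : ∀ n, ‖u n‖ ≤ C)
    (xs : ℕ → ℝ) {a c : ℝ} (hxs : ∀ n, xs n ∈ Set.Icc a c)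
    (hGal : ∀ n, (span 𝕜 (b '' F n)).topologicalClosure.starProjection
        ((x₀ : 𝕜) • b.diagonalCLM d (u n) - u n + T (u n)) = (xs n : 𝕜) • b.diagonalCLM d (u n))
    -- the two bracket ends are not eigenvalues (Theorem 1′ (a))
    (hinj_a : ∀ w, ((1 : H →L[𝕜] H) - T - ((x₀ : 𝕜) - (a : 𝕜)) • b.diagonalCLM d) w = 0 → w = 0)
    (hinj_c : ∀ w, ((1 : H →L[𝕜] H) - T - ((x₀ : 𝕜) - (c : 𝕜)) • b.diagonalCLM d) w = 0 → w = 0) :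
    ∃ lam ∈ Set.Ioo a c, ∃ v : H, ‖v‖ = 1 ∧
      (∀ i, (ℓ i : 𝕜) * ⟪b i, v⟫_𝕜 +
          ∑ j ∈ nbr i, (⟪b i, T (b j)⟫_𝕜 * ((x₀ : 𝕜) - (ℓ j : 𝕜))) * ⟪b j, v⟫_𝕜 =
        (lam : 𝕜) * ⟪b i, v⟫_𝕜) ∧
      ∀ s : ℕ, Summable fun i => wgt i ^ (2 * s) * ‖⟪b i, v⟫_𝕜‖ ^ 2 := by
  set S₀ : H →L[𝕜] H := b.diagonalCLM d with hS₀
  -- Step 1: the eigenpair in resolvent coordinates, closed bracket + conditional open bracket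
  obtain ⟨lam, -, w, hw1, hw, hIoo⟩ :=
    SkewCutGalerkinPerturbation.exists_eigenpair_of_galerkin_brackets_diagonal b d hd0 T hT F hF hFex
      u hu hv1 hC x₀ xs hxs hGal
  have hlam : lam ∈ Set.Ioo a c :=
    hIoo (SkewCutGalerkinInjectivity.not_eigenvalue_of_injective S₀ T _ _ hinj_a)
      (SkewCutGalerkinInjectivity.not_eigenvalue_of_injective S₀ T _ _ hinj_c)
  set v : H := S₀ w with hv
  -- Step 2: coordinates `v_i = d_i w_i`, `w_i = (x₀ - ℓ_i) v_i`
  have hvi : ∀ i, ⟪b i, v⟫_𝕜 = d i * ⟪b i, w⟫_𝕜 := fun i => inner_basis_diagonalCLM b d w i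
  have hwi : ∀ i, ⟪b i, w⟫_𝕜 = ((x₀ : 𝕜) - (ℓ i : 𝕜)) * ⟪b i, v⟫_𝕜 := fun i => by
    rw [hvi, ← mul_assoc, mul_comm ((x₀ : 𝕜) - (ℓ i : 𝕜)), hd, one_mul]
  -- Step 3: the eigen-equation in coordinates
  have heig : ∀ i, (ℓ i : 𝕜) * ⟪b i, v⟫_𝕜 +
      ∑ j ∈ nbr i, (⟪b i, T (b j)⟫_𝕜 * ((x₀ : 𝕜) - (ℓ j : 𝕜))) * ⟪b j, v⟫_𝕜 =
        (lam : 𝕜) * ⟪b i, v⟫_𝕜 := by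
    intro i
    have h := congrArg (fun z => ⟪b i, z⟫_𝕜) hw
    simp only [inner_add_right, inner_sub_right, inner_smul_right] at h
    -- h : x₀ * v_i - w_i + ⟪b i, T w⟫ = lam * v_i
    rw [inner_basis_map_eq_sum b T nbr ht0 w i, hwi i] at h
    have hsum : ∑ j ∈ nbr i, ⟪b i, T (b j)⟫_𝕜 * ⟪b j, w⟫_𝕜 =
        ∑ j ∈ nbr i, (⟪b i, T (b j)⟫_𝕜 * ((x₀ : 𝕜) - (ℓ j : 𝕜))) * ⟪b j, v⟫_𝕜 :=
      Finset.sum_congr rfl fun j _ => by rw [hwi j, mul_assoc]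
    rw [hsum] at h
    rw [← h]
    ring
  -- Step 4: form-level energy of `v = S₀ w` is finite (`‖d_i‖ w_i ≤ M`)
  have h1 : Summable fun i => wgt i ^ 2 * ‖⟪b i, v⟫_𝕜‖ ^ 2 := by
    have hpar : Summable fun i => ‖⟪b i, w⟫_𝕜‖ ^ 2 := by
      have h := (b.hasSum_inner_mul_inner w w).summable.norm
      refine h.congr fun i => ?_
      rw [norm_mul, ← inner_conj_symm, RCLike.norm_conj, sq]
    refine Summable.of_nonneg_of_le (fun i => mul_nonneg (sq_nonneg _) (sq_nonneg _)) (fun i => ?_)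
      (hpar.mul_left (M ^ 2))
    rw [hvi, norm_mul, mul_pow, ← mul_assoc]
    refine mul_le_mul_of_nonneg_right ?_ (sq_nonneg _)
    calc wgt i ^ 2 * ‖d i‖ ^ 2 = (‖d i‖ * wgt i) ^ 2 := by ring
      _ ≤ M ^ 2 := pow_le_pow_left₀ (mul_nonneg (norm_nonneg _) (hw0 i)) (hM i) 2
  -- Step 5: the bootstrap
  refine ⟨lam, hlam, v, hw1, heig, fun s => ?_⟩
  exact Literature.Analysis.OperatorTheory.FirstOrderBand.summable_weighted_of_eigen (e := b)
    (w := wgt) (ℓ := ℓ) (nbr := nbr) (a := fun i j => ⟪b i, T (b j)⟫_𝕜 * ((x₀ : 𝕜) - (ℓ j : 𝕜)))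
    (f := v) (lam := (lam : 𝕜)) hw0 hwℓ hK ha hsymm hW hLnn hL heig h1 s

end Summit.NavierStokesRegularity.FluidComputer.SkewCutGalerkinMaster

end
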